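import Literature.Computability.MetaComplexity.EFModAddUAssocSize
import Literature.Computability.MetaComplexity.EFLayout
import Literature.Computability.MetaComplexity.EFModAdd
import HarnessLib

/-!
# The associativity kit of uniform modular addition: one template allocating everything

`EFModAddUAssoc.lean` proves `(a ⊕ b) ⊕ c = a ⊕ (b ⊕ c)` for four given modular adders and
given scratch circuits (`ModAddU.AssocData` with `AssocData.Avail`). For USE inside larger
laws and in the final assembly, this file packages the whole configuration as ONE template
`ModAddU.AssocKit.kitT L` on the `4L` inputs `a, b, c, n` — a `Netlist.layout`
(`EFLayout.lean`) of 19 pieces: the comparators `(a, n)`, `(c, n)`, the four modular adders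
`M₁ = a ⊕ b`, `M₃ = b ⊕ c`, `M₂ = M₁ ⊕ c`, `M₄ = a ⊕ M₃`, and the 13 scratch circuits of
`AssocData` — together with

* `AssocKit.wf_kitT`: well-formedness (so the kit can itself be a piece of larger layouts and
  its definitions extend an `EF` proof, `FregeSystem.isRelaxedEF_extAxioms`);
* `AssocKit.data o L`: the `AssocData` of an occurrence `o` of the kit and
  `AssocKit.avail_data`: its availability from the availability of the occurrence;
* `AssocKit.isBlock`: the associativity block for an available occurrence, from the facts
  `a < n`, `c < n` about the kit's own comparators, and `AssocKit.mem`: its conclusion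
  `R(M₂)ᵢ ↔ R(M₄)ᵢ`.

A consumer relates its own modular adders to `M₁ … M₄` by congruence
(`ModAddU.PairData.isBlock_leibLines`) and its own comparator facts to the kit's comparators by
`Sub.isBlock_leibLines`.

## Sources

* H. Vollmer, *Introduction to Circuit Complexity* (Springer 1999), §1.2 (composition of
  circuits as straight-line programs).
* S. A. Cook, R. A. Reckhow, *The relative efficiency of propositional proof systems*,
  J. Symbolic Logic 44 (1979), §2, Def. 4.1 (extension).
-/

namespace Literature.Computability.MetaComplexity

open _root_.Computability Complexity Complexity.PropForm Netlist Cluster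

namespace ModAddU

/-- Availability of a modular-adder view transfers along pointwise equal operand words.
[folklore] -/
theorem View.Avail.congr {M M' : View} {K : PropForm ℕ} {Γ : Set (PropForm ℕ)} {L : ℕ} (h : M.Avail K Γ L)
    (hb : M'.base = M.base) (ha : ∀ i < L, M'.a i = M.a i) (hb' : ∀ i < L, M'.b i = M.b i)
    (hn : ∀ i < L, M'.n i = M.n i) : M'.Avail K Γ L := by
  obtain ⟨base, a, b, n⟩ := M
  obtain ⟨base', a', b', n'⟩ := M'
  simp only at hb ha hb' hn
  subst hb
  exact ⟨h.1.congr rfl ha hb', h.2.1.congr rfl (fun i _ => rfl) hn, h.2.2⟩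

/-- The definition lines of an available multiplexer row. [folklore] -/
theorem avail_muxRow {q : Occ} {L : ℕ} {K : PropForm ℕ} {Γ : Set (PropForm ℕ)}
    (hq : q.Avail (ModAdd.muxRow L) (2 * L + 1) K Γ) {i : ℕ} (hi : i < L) :
    ctx K (AssocData.muxLine (q.wire i) (q.inp 0) (q.inp (1 + i)) (q.inp (1 + L + i))) ∈ Γ := by
  have h := hq i (by simpa using hi)
  rw [ModAdd.getElem_muxRow] at h
  simpa [Inst.body, Kind.body, arg, AssocData.muxLine, Occ.ref_inl q (show 0 < 2 * L + 1 by omega),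
    Occ.ref_inl q (show 1 + i < 2 * L + 1 by omega), Occ.ref_inl q (show 1 + L + i < 2 * L + 1 by omega)] using h

/-- The definition line of multiplexer `i` of an available row, with its wires named by equations
(so that the conclusion is matched syntactically). [folklore] -/
theorem avail_muxRow' {q : Occ} {L : ℕ} {K : PropForm ℕ} {Γ : Set (PropForm ℕ)}
    (hq : q.Avail (ModAdd.muxRow L) (2 * L + 1) K Γ) {i : ℕ} (hi : i < L) {g s x y : ℕ} (e0 : q.wire i = g)
    (e1 : q.inp 0 = s) (e2 : q.inp (1 + i) = x) (e3 : q.inp (1 + L + i) = y) :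
    ctx K (AssocData.muxLine g s x y) ∈ Γ := by
  subst e0 e1 e2 e3; exact avail_muxRow hq hi

namespace AssocKit

variable (L : ℕ)

/-! ### The pieces and their offsets -/

/-- The offset of piece `k` (closed form; a chain of literal tests, cheap to unfold). [folklore] -/
def off (L : ℕ) (k : ℕ) : ℕ :=
  if k = 0 then 0 else
  if k = 1 then 3 * L + 1 else
  if k = 2 then 6 * L + 2 else
  if k = 3 then 12 * L + 4 else
  if k = 4 then 18 * L + 6 else
  if k = 5 then 24 * L + 8 else
  if k = 6 then 30 * L + 10 else
  if k = 7 then 32 * L + 11 else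
  if k = 8 then 35 * L + 12 else
  if k = 9 then 36 * L + 12 else
  if k = 10 then 39 * L + 13 else
  if k = 11 then 40 * L + 13 else
  if k = 12 then 43 * L + 14 else
  if k = 13 then 44 * L + 14 else
  if k = 14 then 45 * L + 14 else
  if k = 15 then 48 * L + 15 else
  if k = 16 then 49 * L + 15 else
  if k = 17 then 51 * L + 16 else
  if k = 18 then 54 * L + 17 else
  55 * L + 17

/-- Wiring of a subtractor `x - n` whose minuend is a word of earlier gates `x`. [folklore] -/
def wSubOn (x : ℕ → ℕ) (i : ℕ) : ℕ ⊕ ℕ := if i < L then Sum.inr (x i) else Sum.inl (2 * L + i)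

/-- Wiring of a multiplexer row `sel ? xᵢ : yᵢ` on earlier gates. [folklore] -/
def wMux (sel : ℕ) (x y : ℕ → ℕ) (t : ℕ) : ℕ ⊕ ℕ :=
  if t = 0 then Sum.inr sel else if t ≤ L then Sum.inr (x (t - 1)) else Sum.inr (y (t - 1 - L))

/-- The 19 pieces of the kit (inputs of the kit: `a` = `0…L-1`, `b` = `L…2L-1`, `c` = `2L…3L-1`,
`n` = `3L…4L-1`): the comparators `A = (a, n)`, `C = (c, n)`; `M₁ = a ⊕ b`, `M₃ = b ⊕ c`,
`M₂ = M₁ ⊕ c`, `M₄ = a ⊕ M₃`; `Y`, `E1`, `y1s`, `E2s`, `y1T`, `E2T`, `wT`, `y1V`, `E2V`, `wV`, `AU`,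
`EAU`, `zV` (cf. `ModAddU.AssocData`); a chain of literal tests, cheap to unfold.
[cite: Vollmer1999, §1.2] -/
def pieces (L : ℕ) (k : ℕ) : Piece :=
  if k = 0 then ⟨Sub.subT L, 2 * L, fun i => if i < L then Sum.inl i else Sum.inl (2 * L + i)⟩ else
  if k = 1 then ⟨Sub.subT L, 2 * L, fun i => Sum.inl (2 * L + i)⟩ else
  if k = 2 then ⟨modAddT L, 3 * L, fun i => if i < 2 * L then Sum.inl i else Sum.inl (L + i)⟩ else
  if k = 3 then ⟨modAddT L, 3 * L, fun i => Sum.inl (L + i)⟩ else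
  if k = 4 then ⟨modAddT L, 3 * L, fun i => if i < L then Sum.inr (off L 2 + (5 * L + 2) + i) else Sum.inl (L + i)⟩ else
  if k = 5 then ⟨modAddT L, 3 * L, fun i => if i < L then Sum.inl i else
      if i < 2 * L then Sum.inr (off L 3 + (5 * L + 2) + (i - L)) else Sum.inl (L + i)⟩ else
  if k = 6 then ⟨Adder.addT false L, 2 * L, fun i => if i < L then Sum.inr (off L 2 + (2 * i + 1)) else Sum.inl (L + i)⟩ else
  if k = 7 then ⟨Sub.subT L, 2 * L, wSubOn L fun i => off L 6 + (2 * i + 1)⟩ else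
  if k = 8 then ⟨ModAdd.muxRow L, 2 * L + 1, wMux L (off L 7 + L + 2 * L) (fun i => off L 7 + L + (2 * i + 1))
      fun i => off L 6 + (2 * i + 1)⟩ else
  if k = 9 then ⟨Sub.subT L, 2 * L, wSubOn L fun i => off L 8 + i⟩ else
  if k = 10 then ⟨ModAdd.muxRow L, 2 * L + 1, wMux L (off L 2 + (2 * L + 1) + L + 2 * L)
      (fun i => off L 7 + L + (2 * i + 1)) fun i => off L 6 + (2 * i + 1)⟩ else
  if k = 11 then ⟨Sub.subT L, 2 * L, wSubOn L fun i => off L 10 + i⟩ else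
  if k = 12 then ⟨ModAdd.muxRow L, 2 * L + 1, wMux L (off L 4 + (2 * L + 1) + L + 2 * L)
      (fun i => off L 11 + L + (2 * i + 1)) fun i => off L 10 + i⟩ else
  if k = 13 then ⟨ModAdd.muxRow L, 2 * L + 1, wMux L (off L 3 + (2 * L + 1) + L + 2 * L)
      (fun i => off L 7 + L + (2 * i + 1)) fun i => off L 6 + (2 * i + 1)⟩ else
  if k = 14 then ⟨Sub.subT L, 2 * L, wSubOn L fun i => off L 13 + i⟩ else
  if k = 15 then ⟨ModAdd.muxRow L, 2 * L + 1, wMux L (off L 5 + (2 * L + 1) + L + 2 * L)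
      (fun i => off L 14 + L + (2 * i + 1)) fun i => off L 13 + i⟩ else
  if k = 16 then ⟨Adder.addT false L, 2 * L, fun i => if i < L then Sum.inl i else Sum.inr (off L 3 + (2 * (i - L) + 1))⟩ else
  if k = 17 then ⟨Sub.subT L, 2 * L, wSubOn L fun i => off L 16 + (2 * i + 1)⟩ else
  if k = 18 then ⟨ModAdd.muxRow L, 2 * L + 1, wMux L (off L 3 + (2 * L + 1) + L + 2 * L)
      (fun i => off L 17 + L + (2 * i + 1)) fun i => off L 16 + (2 * i + 1)⟩ else
  ⟨[], 0, Sum.inl⟩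

/-! ### Unfolding lemmas (by `rfl`, cheap) -/

/-- The offsets, unfolded. [folklore] -/
theorem off_eq (L : ℕ) :
    off L 0 = 0 ∧
    off L 1 = 3 * L + 1 ∧
    off L 2 = 6 * L + 2 ∧
    off L 3 = 12 * L + 4 ∧
    off L 4 = 18 * L + 6 ∧
    off L 5 = 24 * L + 8 ∧
    off L 6 = 30 * L + 10 ∧
    off L 7 = 32 * L + 11 ∧
    off L 8 = 35 * L + 12 ∧
    off L 9 = 36 * L + 12 ∧
    off L 10 = 39 * L + 13 ∧
    off L 11 = 40 * L + 13 ∧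
    off L 12 = 43 * L + 14 ∧
    off L 13 = 44 * L + 14 ∧
    off L 14 = 45 * L + 14 ∧
    off L 15 = 48 * L + 15 ∧
    off L 16 = 49 * L + 15 ∧
    off L 17 = 51 * L + 16 ∧
    off L 18 = 54 * L + 17 ∧ off L 19 = 55 * L + 17 :=
  ⟨rfl, rfl, rfl, rfl, rfl, rfl, rfl, rfl, rfl, rfl, rfl, rfl, rfl, rfl, rfl, rfl, rfl, rfl, rfl, rfl⟩

/-- Piece `0`, unfolded. [folklore] -/
theorem pieces_0 (L : ℕ) : pieces L 0 = ⟨Sub.subT L, 2 * L, fun i => if i < L then Sum.inl i else Sum.inl (2 * L + i)⟩ := rfl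

/-- Piece `1`, unfolded. [folklore] -/
theorem pieces_1 (L : ℕ) : pieces L 1 = ⟨Sub.subT L, 2 * L, fun i => Sum.inl (2 * L + i)⟩ := rfl

/-- Piece `2`, unfolded. [folklore] -/
theorem pieces_2 (L : ℕ) : pieces L 2 = ⟨modAddT L, 3 * L, fun i => if i < 2 * L then Sum.inl i else Sum.inl (L + i)⟩ := rfl

/-- Piece `3`, unfolded. [folklore] -/
theorem pieces_3 (L : ℕ) : pieces L 3 = ⟨modAddT L, 3 * L, fun i => Sum.inl (L + i)⟩ := rfl

/-- Piece `4`, unfolded. [folklore] -/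
theorem pieces_4 (L : ℕ) : pieces L 4 = ⟨modAddT L, 3 * L, fun i => if i < L then Sum.inr (off L 2 + (5 * L + 2) + i) else Sum.inl (L + i)⟩ := rfl

/-- Piece `5`, unfolded. [folklore] -/
theorem pieces_5 (L : ℕ) : pieces L 5 = ⟨modAddT L, 3 * L, fun i => if i < L then Sum.inl i else
      if i < 2 * L then Sum.inr (off L 3 + (5 * L + 2) + (i - L)) else Sum.inl (L + i)⟩ := rfl

/-- Piece `6`, unfolded. [folklore] -/
theorem pieces_6 (L : ℕ) : pieces L 6 = ⟨Adder.addT false L, 2 * L, fun i => if i < L then Sum.inr (off L 2 + (2 * i + 1)) else Sum.inl (L + i)⟩ := rfl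

/-- Piece `7`, unfolded. [folklore] -/
theorem pieces_7 (L : ℕ) : pieces L 7 = ⟨Sub.subT L, 2 * L, wSubOn L fun i => off L 6 + (2 * i + 1)⟩ := rfl

/-- Piece `8`, unfolded. [folklore] -/
theorem pieces_8 (L : ℕ) : pieces L 8 = ⟨ModAdd.muxRow L, 2 * L + 1, wMux L (off L 7 + L + 2 * L) (fun i => off L 7 + L + (2 * i + 1))
      fun i => off L 6 + (2 * i + 1)⟩ := rfl

/-- Piece `9`, unfolded. [folklore] -/
theorem pieces_9 (L : ℕ) : pieces L 9 = ⟨Sub.subT L, 2 * L, wSubOn L fun i => off L 8 + i⟩ := rfl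

/-- Piece `10`, unfolded. [folklore] -/
theorem pieces_10 (L : ℕ) : pieces L 10 = ⟨ModAdd.muxRow L, 2 * L + 1, wMux L (off L 2 + (2 * L + 1) + L + 2 * L)
      (fun i => off L 7 + L + (2 * i + 1)) fun i => off L 6 + (2 * i + 1)⟩ := rfl

/-- Piece `11`, unfolded. [folklore] -/
theorem pieces_11 (L : ℕ) : pieces L 11 = ⟨Sub.subT L, 2 * L, wSubOn L fun i => off L 10 + i⟩ := rfl

/-- Piece `12`, unfolded. [folklore] -/
theorem pieces_12 (L : ℕ) : pieces L 12 = ⟨ModAdd.muxRow L, 2 * L + 1, wMux L (off L 4 + (2 * L + 1) + L + 2 * L)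
      (fun i => off L 11 + L + (2 * i + 1)) fun i => off L 10 + i⟩ := rfl

/-- Piece `13`, unfolded. [folklore] -/
theorem pieces_13 (L : ℕ) : pieces L 13 = ⟨ModAdd.muxRow L, 2 * L + 1, wMux L (off L 3 + (2 * L + 1) + L + 2 * L)
      (fun i => off L 7 + L + (2 * i + 1)) fun i => off L 6 + (2 * i + 1)⟩ := rfl

/-- Piece `14`, unfolded. [folklore] -/
theorem pieces_14 (L : ℕ) : pieces L 14 = ⟨Sub.subT L, 2 * L, wSubOn L fun i => off L 13 + i⟩ := rfl

/-- Piece `15`, unfolded. [folklore] -/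
theorem pieces_15 (L : ℕ) : pieces L 15 = ⟨ModAdd.muxRow L, 2 * L + 1, wMux L (off L 5 + (2 * L + 1) + L + 2 * L)
      (fun i => off L 14 + L + (2 * i + 1)) fun i => off L 13 + i⟩ := rfl

/-- Piece `16`, unfolded. [folklore] -/
theorem pieces_16 (L : ℕ) : pieces L 16 = ⟨Adder.addT false L, 2 * L, fun i => if i < L then Sum.inl i else Sum.inr (off L 3 + (2 * (i - L) + 1))⟩ := rfl

/-- Piece `17`, unfolded. [folklore] -/
theorem pieces_17 (L : ℕ) : pieces L 17 = ⟨Sub.subT L, 2 * L, wSubOn L fun i => off L 16 + (2 * i + 1)⟩ := rfl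

/-- Piece `18`, unfolded. [folklore] -/
theorem pieces_18 (L : ℕ) : pieces L 18 = ⟨ModAdd.muxRow L, 2 * L + 1, wMux L (off L 3 + (2 * L + 1) + L + 2 * L)
      (fun i => off L 17 + L + (2 * i + 1)) fun i => off L 16 + (2 * i + 1)⟩ := rfl

/-- **The associativity kit**: the layout of the 19 pieces. [cite: Vollmer1999, §1.2] -/
def kitT (L : ℕ) : Template := layout (pieces L) 19

/-- The offsets of the pieces are the closed forms `off`. [folklore] -/
theorem offset_pieces : ∀ k ≤ 19, offset (pieces L) k = off L k := by
  have step : ∀ k < 19, offset (pieces L) k = off L k → offset (pieces L) (k + 1) = off L (k + 1) := by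
    intro k hk h
    rw [offset_succ, h]
    obtain ⟨o0, o1, o2, o3, o4, o5, o6, o7, o8, o9, o10, o11, o12, o13, o14, o15, o16, o17, o18, o19⟩ := off_eq L
    interval_cases k <;> simp only [pieces_0, pieces_1, pieces_2, pieces_3, pieces_4, pieces_5, pieces_6, pieces_7, pieces_8, pieces_9, pieces_10, pieces_11, pieces_12, pieces_13, pieces_14, pieces_15, pieces_16, pieces_17, pieces_18, o0, o1, o2, o3, o4, o5, o6, o7, o8, o9, o10, o11, o12, o13, o14,
      o15, o16, o17, o18, o19, Sub.length_subT, length_modAddT, Adder.length_addT, ModAdd.length_muxRow] <;> ring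
  intro k hk
  induction k with
  | zero => rfl
  | succ k ih => exact step k (by omega) (ih (by omega))

/-- Length of the kit: `55L + 17` gates. [folklore] -/
@[simp] theorem length_kitT : (kitT L).length = 55 * L + 17 := by
  rw [kitT, length_layout, offset_pieces L 19 le_rfl]; rfl

/-- Every piece is well formed and well wired (`4L` inputs). [cite: Vollmer1999, Def. 1.6] -/
theorem piece_ok : ∀ k < 19, Piece.OK (pieces L) (4 * L) k := by
  intro k hk
  have hoff := offset_pieces L k (by omega)
  unfold Piece.OK
  rw [hoff]
  interval_cases k <;> simp only [pieces_0, pieces_1, pieces_2, pieces_3, pieces_4, pieces_5, pieces_6, pieces_7, pieces_8, pieces_9, pieces_10, pieces_11, pieces_12, pieces_13, pieces_14, pieces_15, pieces_16, pieces_17, pieces_18]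
  · exact ⟨Sub.wf_subT L, fun i hi => by split_ifs <;> exact ⟨fun a ha => (by cases ha; omega), fun g hg => by cases hg⟩⟩
  · exact ⟨Sub.wf_subT L, fun i hi => ⟨fun a ha => (by cases ha; omega), fun g hg => by cases hg⟩⟩
  · exact ⟨wf_modAddT L, fun i hi => by split_ifs <;> exact ⟨fun a ha => (by cases ha; omega), fun g hg => by cases hg⟩⟩
  · exact ⟨wf_modAddT L, fun i hi => ⟨fun a ha => (by cases ha; omega), fun g hg => by cases hg⟩⟩
  · exact ⟨wf_modAddT L, fun i hi => by
      split_ifs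
      · exact ⟨fun a ha => (by cases ha), fun g hg => by cases hg; simp only [off_eq] ; omega⟩
      · exact ⟨fun a ha => (by cases ha; omega), fun g hg => by cases hg⟩⟩
  · exact ⟨wf_modAddT L, fun i hi => by
      split_ifs
      · exact ⟨fun a ha => (by cases ha; omega), fun g hg => by cases hg⟩
      · exact ⟨fun a ha => (by cases ha), fun g hg => by cases hg; simp only [off_eq] ; omega⟩
      · exact ⟨fun a ha => (by cases ha; omega), fun g hg => by cases hg⟩⟩
  · exact ⟨Adder.wf_addT false L, fun i hi => by
      split_ifs
      · exact ⟨fun a ha => (by cases ha), fun g hg => by cases hg; simp only [off_eq] ; omega⟩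
      · exact ⟨fun a ha => (by cases ha; omega), fun g hg => by cases hg⟩⟩
  all_goals first
    | exact ⟨Sub.wf_subT L, fun i hi => by
        unfold wSubOn; split_ifs
        · exact ⟨fun a ha => (by cases ha), fun g hg => by cases hg; simp only [off_eq] ; omega⟩
        · exact ⟨fun a ha => (by cases ha; omega), fun g hg => by cases hg⟩⟩
    | exact ⟨ModAdd.wf_muxRow L, fun i hi => by
        unfold wMux; split_ifs
        · exact ⟨fun a ha => (by cases ha), fun g hg => by cases hg; simp only [off_eq] ; omega⟩
        · exact ⟨fun a ha => (by cases ha), fun g hg => by cases hg; simp only [off_eq] ; omega⟩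
        · exact ⟨fun a ha => (by cases ha), fun g hg => by cases hg; simp only [off_eq] ; omega⟩⟩
    | exact ⟨Adder.wf_addT false L, fun i hi => by
        split_ifs
        · exact ⟨fun a ha => (by cases ha; omega), fun g hg => by cases hg⟩
        · exact ⟨fun a ha => (by cases ha), fun g hg => by cases hg; simp only [off_eq] ; omega⟩⟩

/-- **The kit is well formed** (`4L` inputs). [cite: Vollmer1999, Def. 1.6] -/
theorem wf_kitT : (kitT L).WF (4 * L) := wf_layout (pieces L) (piece_ok L)

/-! ### The data of an occurrence of the kit -/

/-- The `AssocData` of an occurrence `o` of the kit. [folklore] -/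
def data (o : Occ) (L : ℕ) : AssocData where
  L := L
  a := fun i => o.inp i
  b := fun i => o.inp (L + i)
  c := fun i => o.inp (2 * L + i)
  n := fun i => o.inp (3 * L + i)
  b₁ := o.base + off L 2
  b₂ := o.base + off L 4
  b₃ := o.base + off L 3
  b₄ := o.base + off L 5
  bA := o.base + off L 0
  bC := o.base + off L 1
  bY := o.base + off L 6
  bE1 := o.base + off L 7
  by1s := o.base + off L 8
  bE2s := o.base + off L 9
  by1T := o.base + off L 10
  bE2T := o.base + off L 11
  bwT := o.base + off L 12
  by1V := o.base + off L 13
  bE2V := o.base + off L 14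
  bwV := o.base + off L 15
  bAU := o.base + off L 16
  bEAU := o.base + off L 17
  bzV := o.base + off L 18

variable {L} {o : Occ} {K : PropForm ℕ} {Γ : Set (PropForm ℕ)}

/-- The base of the occurrence of piece `k`. [folklore] -/
theorem base_q {k : ℕ} (hk : k ≤ 19) : (pieceOcc (o.inst (4 * L)) (pieces L) k).base = o.base + off L k := by
  simp [pieceOcc, offset_pieces L k hk]

/-- An input of a piece wired to an input of the kit. [folklore] -/
theorem inp_q_inl {k i j : ℕ} (hw : (pieces L k).wire i = Sum.inl j) (hj : j < 4 * L) :
    (pieceOcc (o.inst (4 * L)) (pieces L) k).inp i = o.inp j := by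
  rw [inp_pieceOcc, hw, Occ.ref_inl o hj]

/-- An input of a piece wired to an earlier gate of the kit. [folklore] -/
theorem inp_q_inr {k i g : ℕ} (hw : (pieces L k).wire i = Sum.inr g) :
    (pieceOcc (o.inst (4 * L)) (pieces L) k).inp i = o.base + g := by
  rw [inp_pieceOcc, hw, Occ.ref_inr]; rfl

/-- Availability of the modular adder `M₁` of an available kit. [folklore] -/
theorem avail_M₁ (ho : o.Avail (kitT L) (4 * L) K Γ) : (data o L).M₁.Avail K Γ L := by
  have hq : (pieceOcc (o.inst (4 * L)) (pieces L) 2).Avail (modAddT L) (3 * L) K Γ := by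
    have := Inst.DefsAvail.piece ho (k := 2) (by norm_num) (by rw [pieces_2]; exact wf_modAddT L)
    rw [pieces_2] at this; exact this
  have h := ModAddU.avail_viewOf hq
  refine h.congr ?_ (fun i hi => ?_) (fun i hi => ?_) (fun i hi => ?_)
  · show o.base + off L 2 = (pieceOcc (o.inst (4 * L)) (pieces L) 2).base
    rw [base_q (by norm_num)]
  · show o.inp i = ((pieceOcc (o.inst (4 * L)) (pieces L) 2).inst (3 * L)).inputs.getD i 0
    rw [Occ.getD_inst _ (show i < 3 * L by omega),
      inp_q_inl (k := 2) (i := i) (j := i) (by simp only [pieces_2]; rw [if_pos (by omega)]) (by omega)]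
  · show o.inp (L + i) = ((pieceOcc (o.inst (4 * L)) (pieces L) 2).inst (3 * L)).inputs.getD (L + i) 0
    rw [Occ.getD_inst _ (show L + i < 3 * L by omega),
      inp_q_inl (k := 2) (i := L + i) (j := L + i) (by simp only [pieces_2]; rw [if_pos (by omega)]) (by omega)]
  · show o.inp (3 * L + i) = ((pieceOcc (o.inst (4 * L)) (pieces L) 2).inst (3 * L)).inputs.getD (2 * L + i) 0
    rw [Occ.getD_inst _ (show 2 * L + i < 3 * L by omega),
      inp_q_inl (k := 2) (i := 2 * L + i) (j := 3 * L + i) (by simp only [pieces_2]; rw [if_neg (by omega)]; congr 1; omega)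
        (by omega)]

/-- Availability of the comparator `(a, n)` of an available kit. [folklore] -/
theorem avail_A (ho : o.Avail (kitT L) (4 * L) K Γ) : (data o L).A.Avail K Γ L := by
  have hq : (pieceOcc (o.inst (4 * L)) (pieces L) 0).Avail (Sub.subT L) (2 * L) K Γ := by
    have := Inst.DefsAvail.piece ho (k := 0) (by norm_num) (by rw [pieces_0]; exact Sub.wf_subT L)
    rw [pieces_0] at this; exact this
  have h := Sub.avail_viewOf hq
  refine h.congr ?_ (fun i hi => ?_) (fun i hi => ?_)
  · show o.base + off L 0 = (pieceOcc (o.inst (4 * L)) (pieces L) 0).base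
    rw [base_q (by norm_num)]
  · show o.inp i = ((pieceOcc (o.inst (4 * L)) (pieces L) 0).inst (2 * L)).inputs.getD (i) 0
    rw [Occ.getD_inst _ (show i < 2 * L by omega),
      inp_q_inl (k := 0) (i := i) (j := i) (by simp only [pieces_0]; rw [if_pos hi]) (by omega)]
  · show o.inp (3 * L + i) = ((pieceOcc (o.inst (4 * L)) (pieces L) 0).inst (2 * L)).inputs.getD (L + i) 0
    rw [Occ.getD_inst _ (show L + i < 2 * L by omega),
      inp_q_inl (k := 0) (i := L + i) (j := 3 * L + i) (by simp only [pieces_0]; rw [if_neg (by omega)]; congr 1; omega) (by omega)]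

/-- Availability of the comparator `(c, n)`. [folklore] -/
theorem avail_C (ho : o.Avail (kitT L) (4 * L) K Γ) : (data o L).C.Avail K Γ L := by
  have hq : (pieceOcc (o.inst (4 * L)) (pieces L) 1).Avail (Sub.subT L) (2 * L) K Γ := by
    have := Inst.DefsAvail.piece ho (k := 1) (by norm_num) (by rw [pieces_1]; exact Sub.wf_subT L)
    rw [pieces_1] at this; exact this
  have h := Sub.avail_viewOf hq
  refine h.congr ?_ (fun i hi => ?_) (fun i hi => ?_)
  · show o.base + off L 1 = (pieceOcc (o.inst (4 * L)) (pieces L) 1).base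
    rw [base_q (by norm_num)]
  · show o.inp (2 * L + i) = ((pieceOcc (o.inst (4 * L)) (pieces L) 1).inst (2 * L)).inputs.getD (i) 0
    rw [Occ.getD_inst _ (show i < 2 * L by omega),
      inp_q_inl (k := 1) (i := i) (j := 2 * L + i) (by rfl) (by omega)]
  · show o.inp (3 * L + i) = ((pieceOcc (o.inst (4 * L)) (pieces L) 1).inst (2 * L)).inputs.getD (L + i) 0
    rw [Occ.getD_inst _ (show L + i < 2 * L by omega),
      inp_q_inl (k := 1) (i := L + i) (j := 3 * L + i) (by simp only [pieces_1]; congr 1; omega) (by omega)]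

/-- Availability of `M₃ = b ⊕ c`. [folklore] -/
theorem avail_M₃ (ho : o.Avail (kitT L) (4 * L) K Γ) : (data o L).M₃.Avail K Γ L := by
  have hq : (pieceOcc (o.inst (4 * L)) (pieces L) 3).Avail (modAddT L) (3 * L) K Γ := by
    have := Inst.DefsAvail.piece ho (k := 3) (by norm_num) (by rw [pieces_3]; exact wf_modAddT L)
    rw [pieces_3] at this; exact this
  have h := ModAddU.avail_viewOf hq
  refine h.congr ?_ (fun i hi => ?_) (fun i hi => ?_) (fun i hi => ?_)
  · show o.base + off L 3 = (pieceOcc (o.inst (4 * L)) (pieces L) 3).base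
    rw [base_q (by norm_num)]
  · show o.inp (L + i) = ((pieceOcc (o.inst (4 * L)) (pieces L) 3).inst (3 * L)).inputs.getD (i) 0
    rw [Occ.getD_inst _ (show i < 3 * L by omega),
      inp_q_inl (k := 3) (i := i) (j := L + i) (by rfl) (by omega)]
  · show o.inp (2 * L + i) = ((pieceOcc (o.inst (4 * L)) (pieces L) 3).inst (3 * L)).inputs.getD (L + i) 0
    rw [Occ.getD_inst _ (show L + i < 3 * L by omega),
      inp_q_inl (k := 3) (i := L + i) (j := 2 * L + i) (by simp only [pieces_3]; congr 1; omega) (by omega)]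
  · show o.inp (3 * L + i) = ((pieceOcc (o.inst (4 * L)) (pieces L) 3).inst (3 * L)).inputs.getD (2 * L + i) 0
    rw [Occ.getD_inst _ (show 2 * L + i < 3 * L by omega),
      inp_q_inl (k := 3) (i := 2 * L + i) (j := 3 * L + i) (by simp only [pieces_3]; congr 1; omega) (by omega)]

/-- Availability of `M₂ = M₁ ⊕ c`. [folklore] -/
theorem avail_M₂ (ho : o.Avail (kitT L) (4 * L) K Γ) : (data o L).M₂.Avail K Γ L := by
  have hq : (pieceOcc (o.inst (4 * L)) (pieces L) 4).Avail (modAddT L) (3 * L) K Γ := by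
    have := Inst.DefsAvail.piece ho (k := 4) (by norm_num) (by rw [pieces_4]; exact wf_modAddT L)
    rw [pieces_4] at this; exact this
  have h := ModAddU.avail_viewOf hq
  refine h.congr ?_ (fun i hi => ?_) (fun i hi => ?_) (fun i hi => ?_)
  · show o.base + off L 4 = (pieceOcc (o.inst (4 * L)) (pieces L) 4).base
    rw [base_q (by norm_num)]
  · show o.base + off L 2 + (5 * L + 2) + i = ((pieceOcc (o.inst (4 * L)) (pieces L) 4).inst (3 * L)).inputs.getD (i) 0
    rw [Occ.getD_inst _ (show i < 3 * L by omega),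
      inp_q_inr (k := 4) (i := i) (g := off L 2 + (5 * L + 2) + i) (by simp only [pieces_4]; rw [if_pos hi])]
    omega
  · show o.inp (2 * L + i) = ((pieceOcc (o.inst (4 * L)) (pieces L) 4).inst (3 * L)).inputs.getD (L + i) 0
    rw [Occ.getD_inst _ (show L + i < 3 * L by omega),
      inp_q_inl (k := 4) (i := L + i) (j := 2 * L + i) (by simp only [pieces_4]; rw [if_neg (by omega)]; congr 1; omega) (by omega)]
  · show o.inp (3 * L + i) = ((pieceOcc (o.inst (4 * L)) (pieces L) 4).inst (3 * L)).inputs.getD (2 * L + i) 0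
    rw [Occ.getD_inst _ (show 2 * L + i < 3 * L by omega),
      inp_q_inl (k := 4) (i := 2 * L + i) (j := 3 * L + i) (by simp only [pieces_4]; rw [if_neg (by omega)]; congr 1; omega) (by omega)]

/-- Availability of `M₄ = a ⊕ M₃`. [folklore] -/
theorem avail_M₄ (ho : o.Avail (kitT L) (4 * L) K Γ) : (data o L).M₄.Avail K Γ L := by
  have hq : (pieceOcc (o.inst (4 * L)) (pieces L) 5).Avail (modAddT L) (3 * L) K Γ := by
    have := Inst.DefsAvail.piece ho (k := 5) (by norm_num) (by rw [pieces_5]; exact wf_modAddT L)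
    rw [pieces_5] at this; exact this
  have h := ModAddU.avail_viewOf hq
  refine h.congr ?_ (fun i hi => ?_) (fun i hi => ?_) (fun i hi => ?_)
  · show o.base + off L 5 = (pieceOcc (o.inst (4 * L)) (pieces L) 5).base
    rw [base_q (by norm_num)]
  · show o.inp i = ((pieceOcc (o.inst (4 * L)) (pieces L) 5).inst (3 * L)).inputs.getD (i) 0
    rw [Occ.getD_inst _ (show i < 3 * L by omega),
      inp_q_inl (k := 5) (i := i) (j := i) (by simp only [pieces_5]; rw [if_pos hi]) (by omega)]
  · show o.base + off L 3 + (5 * L + 2) + i = ((pieceOcc (o.inst (4 * L)) (pieces L) 5).inst (3 * L)).inputs.getD (L + i) 0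
    rw [Occ.getD_inst _ (show L + i < 3 * L by omega),
      inp_q_inr (k := 5) (i := L + i) (g := off L 3 + (5 * L + 2) + (L + i - L)) (by simp only [pieces_5]; rw [if_neg (by omega), if_pos (by omega)])]
    omega
  · show o.inp (3 * L + i) = ((pieceOcc (o.inst (4 * L)) (pieces L) 5).inst (3 * L)).inputs.getD (2 * L + i) 0
    rw [Occ.getD_inst _ (show 2 * L + i < 3 * L by omega),
      inp_q_inl (k := 5) (i := 2 * L + i) (j := 3 * L + i) (by simp only [pieces_5]; rw [if_neg (by omega), if_neg (by omega)]; congr 1; omega) (by omega)]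

/-- Availability of `Y = S₁ + c`. [folklore] -/
theorem avail_Y (ho : o.Avail (kitT L) (4 * L) K Γ) : (data o L).Y.Avail K Γ false L := by
  have hq : (pieceOcc (o.inst (4 * L)) (pieces L) 6).Avail (Adder.addT false L) (2 * L) K Γ := by
    have := Inst.DefsAvail.piece ho (k := 6) (by norm_num) (by rw [pieces_6]; exact Adder.wf_addT false L)
    rw [pieces_6] at this; exact this
  have h := Adder.avail_viewOf hq
  refine h.congr ?_ (fun i hi => ?_) (fun i hi => ?_)
  · show o.base + off L 6 = (pieceOcc (o.inst (4 * L)) (pieces L) 6).base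
    rw [base_q (by norm_num)]
  · show o.base + off L 2 + (2 * i + 1) = ((pieceOcc (o.inst (4 * L)) (pieces L) 6).inst (2 * L)).inputs.getD (i) 0
    rw [Occ.getD_inst _ (show i < 2 * L by omega),
      inp_q_inr (k := 6) (i := i) (g := off L 2 + (2 * i + 1)) (by simp only [pieces_6]; rw [if_pos hi])]
    omega
  · show o.inp (2 * L + i) = ((pieceOcc (o.inst (4 * L)) (pieces L) 6).inst (2 * L)).inputs.getD (L + i) 0
    rw [Occ.getD_inst _ (show L + i < 2 * L by omega),
      inp_q_inl (k := 6) (i := L + i) (j := 2 * L + i) (by simp only [pieces_6]; rw [if_neg (by omega)]; congr 1; omega) (by omega)]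

/-- Availability of `E1 = Y - n`. [folklore] -/
theorem avail_E1 (ho : o.Avail (kitT L) (4 * L) K Γ) : (data o L).E1.Avail K Γ L := by
  have hq : (pieceOcc (o.inst (4 * L)) (pieces L) 7).Avail (Sub.subT L) (2 * L) K Γ := by
    have := Inst.DefsAvail.piece ho (k := 7) (by norm_num) (by rw [pieces_7]; exact Sub.wf_subT L)
    rw [pieces_7] at this; exact this
  have h := Sub.avail_viewOf hq
  refine h.congr ?_ (fun i hi => ?_) (fun i hi => ?_)
  · show o.base + off L 7 = (pieceOcc (o.inst (4 * L)) (pieces L) 7).base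
    rw [base_q (by norm_num)]
  · show o.base + off L 6 + (2 * i + 1) = ((pieceOcc (o.inst (4 * L)) (pieces L) 7).inst (2 * L)).inputs.getD (i) 0
    rw [Occ.getD_inst _ (show i < 2 * L by omega),
      inp_q_inr (k := 7) (i := i) (g := off L 6 + (2 * i + 1)) (by simp only [pieces_7, wSubOn]; rw [if_pos hi])]
    omega
  · show o.inp (3 * L + i) = ((pieceOcc (o.inst (4 * L)) (pieces L) 7).inst (2 * L)).inputs.getD (L + i) 0
    rw [Occ.getD_inst _ (show L + i < 2 * L by omega),
      inp_q_inl (k := 7) (i := L + i) (j := 3 * L + i) (by simp only [pieces_7, wSubOn]; rw [if_neg (by omega)]; congr 1; omega) (by omega)]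

/-- Availability of `E2s = y1s - n`. [folklore] -/
theorem avail_E2s (ho : o.Avail (kitT L) (4 * L) K Γ) : (data o L).E2s.Avail K Γ L := by
  have hq : (pieceOcc (o.inst (4 * L)) (pieces L) 9).Avail (Sub.subT L) (2 * L) K Γ := by
    have := Inst.DefsAvail.piece ho (k := 9) (by norm_num) (by rw [pieces_9]; exact Sub.wf_subT L)
    rw [pieces_9] at this; exact this
  have h := Sub.avail_viewOf hq
  refine h.congr ?_ (fun i hi => ?_) (fun i hi => ?_)
  · show o.base + off L 9 = (pieceOcc (o.inst (4 * L)) (pieces L) 9).base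
    rw [base_q (by norm_num)]
  · show o.base + off L 8 + i = ((pieceOcc (o.inst (4 * L)) (pieces L) 9).inst (2 * L)).inputs.getD (i) 0
    rw [Occ.getD_inst _ (show i < 2 * L by omega),
      inp_q_inr (k := 9) (i := i) (g := off L 8 + i) (by simp only [pieces_9, wSubOn]; rw [if_pos hi])]
    omega
  · show o.inp (3 * L + i) = ((pieceOcc (o.inst (4 * L)) (pieces L) 9).inst (2 * L)).inputs.getD (L + i) 0
    rw [Occ.getD_inst _ (show L + i < 2 * L by omega),
      inp_q_inl (k := 9) (i := L + i) (j := 3 * L + i) (by simp only [pieces_9, wSubOn]; rw [if_neg (by omega)]; congr 1; omega) (by omega)]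

/-- Availability of `E2T = y1T - n`. [folklore] -/
theorem avail_E2T (ho : o.Avail (kitT L) (4 * L) K Γ) : (data o L).E2T.Avail K Γ L := by
  have hq : (pieceOcc (o.inst (4 * L)) (pieces L) 11).Avail (Sub.subT L) (2 * L) K Γ := by
    have := Inst.DefsAvail.piece ho (k := 11) (by norm_num) (by rw [pieces_11]; exact Sub.wf_subT L)
    rw [pieces_11] at this; exact this
  have h := Sub.avail_viewOf hq
  refine h.congr ?_ (fun i hi => ?_) (fun i hi => ?_)
  · show o.base + off L 11 = (pieceOcc (o.inst (4 * L)) (pieces L) 11).base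
    rw [base_q (by norm_num)]
  · show o.base + off L 10 + i = ((pieceOcc (o.inst (4 * L)) (pieces L) 11).inst (2 * L)).inputs.getD (i) 0
    rw [Occ.getD_inst _ (show i < 2 * L by omega),
      inp_q_inr (k := 11) (i := i) (g := off L 10 + i) (by simp only [pieces_11, wSubOn]; rw [if_pos hi])]
    omega
  · show o.inp (3 * L + i) = ((pieceOcc (o.inst (4 * L)) (pieces L) 11).inst (2 * L)).inputs.getD (L + i) 0
    rw [Occ.getD_inst _ (show L + i < 2 * L by omega),
      inp_q_inl (k := 11) (i := L + i) (j := 3 * L + i) (by simp only [pieces_11, wSubOn]; rw [if_neg (by omega)]; congr 1; omega) (by omega)]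

/-- Availability of `E2V = y1V - n`. [folklore] -/
theorem avail_E2V (ho : o.Avail (kitT L) (4 * L) K Γ) : (data o L).E2V.Avail K Γ L := by
  have hq : (pieceOcc (o.inst (4 * L)) (pieces L) 14).Avail (Sub.subT L) (2 * L) K Γ := by
    have := Inst.DefsAvail.piece ho (k := 14) (by norm_num) (by rw [pieces_14]; exact Sub.wf_subT L)
    rw [pieces_14] at this; exact this
  have h := Sub.avail_viewOf hq
  refine h.congr ?_ (fun i hi => ?_) (fun i hi => ?_)
  · show o.base + off L 14 = (pieceOcc (o.inst (4 * L)) (pieces L) 14).base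
    rw [base_q (by norm_num)]
  · show o.base + off L 13 + i = ((pieceOcc (o.inst (4 * L)) (pieces L) 14).inst (2 * L)).inputs.getD (i) 0
    rw [Occ.getD_inst _ (show i < 2 * L by omega),
      inp_q_inr (k := 14) (i := i) (g := off L 13 + i) (by simp only [pieces_14, wSubOn]; rw [if_pos hi])]
    omega
  · show o.inp (3 * L + i) = ((pieceOcc (o.inst (4 * L)) (pieces L) 14).inst (2 * L)).inputs.getD (L + i) 0
    rw [Occ.getD_inst _ (show L + i < 2 * L by omega),
      inp_q_inl (k := 14) (i := L + i) (j := 3 * L + i) (by simp only [pieces_14, wSubOn]; rw [if_neg (by omega)]; congr 1; omega) (by omega)]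

/-- Availability of `EAU = AU - n`. [folklore] -/
theorem avail_EAU (ho : o.Avail (kitT L) (4 * L) K Γ) : (data o L).EAU.Avail K Γ L := by
  have hq : (pieceOcc (o.inst (4 * L)) (pieces L) 17).Avail (Sub.subT L) (2 * L) K Γ := by
    have := Inst.DefsAvail.piece ho (k := 17) (by norm_num) (by rw [pieces_17]; exact Sub.wf_subT L)
    rw [pieces_17] at this; exact this
  have h := Sub.avail_viewOf hq
  refine h.congr ?_ (fun i hi => ?_) (fun i hi => ?_)
  · show o.base + off L 17 = (pieceOcc (o.inst (4 * L)) (pieces L) 17).base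
    rw [base_q (by norm_num)]
  · show o.base + off L 16 + (2 * i + 1) = ((pieceOcc (o.inst (4 * L)) (pieces L) 17).inst (2 * L)).inputs.getD (i) 0
    rw [Occ.getD_inst _ (show i < 2 * L by omega),
      inp_q_inr (k := 17) (i := i) (g := off L 16 + (2 * i + 1)) (by simp only [pieces_17, wSubOn]; rw [if_pos hi])]
    omega
  · show o.inp (3 * L + i) = ((pieceOcc (o.inst (4 * L)) (pieces L) 17).inst (2 * L)).inputs.getD (L + i) 0
    rw [Occ.getD_inst _ (show L + i < 2 * L by omega),
      inp_q_inl (k := 17) (i := L + i) (j := 3 * L + i) (by simp only [pieces_17, wSubOn]; rw [if_neg (by omega)]; congr 1; omega) (by omega)]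

/-- Availability of `AU = a + S₃`. [folklore] -/
theorem avail_AU (ho : o.Avail (kitT L) (4 * L) K Γ) : (data o L).AU.Avail K Γ false L := by
  have hq : (pieceOcc (o.inst (4 * L)) (pieces L) 16).Avail (Adder.addT false L) (2 * L) K Γ := by
    have := Inst.DefsAvail.piece ho (k := 16) (by norm_num) (by rw [pieces_16]; exact Adder.wf_addT false L)
    rw [pieces_16] at this; exact this
  have h := Adder.avail_viewOf hq
  refine h.congr ?_ (fun i hi => ?_) (fun i hi => ?_)
  · show o.base + off L 16 = (pieceOcc (o.inst (4 * L)) (pieces L) 16).base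
    rw [base_q (by norm_num)]
  · show o.inp i = ((pieceOcc (o.inst (4 * L)) (pieces L) 16).inst (2 * L)).inputs.getD (i) 0
    rw [Occ.getD_inst _ (show i < 2 * L by omega),
      inp_q_inl (k := 16) (i := i) (j := i) (by simp only [pieces_16]; rw [if_pos hi]) (by omega)]
  · show o.base + off L 3 + (2 * i + 1) = ((pieceOcc (o.inst (4 * L)) (pieces L) 16).inst (2 * L)).inputs.getD (L + i) 0
    rw [Occ.getD_inst _ (show L + i < 2 * L by omega),
      inp_q_inr (k := 16) (i := L + i) (g := off L 3 + (2 * (L + i - L) + 1)) (by simp only [pieces_16]; rw [if_neg (by omega)])]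
    omega

/-- Availability of the multiplexer row of piece `8`. [folklore] -/
theorem hq_8 (ho : o.Avail (kitT L) (4 * L) K Γ) : (pieceOcc (o.inst (4 * L)) (pieces L) 8).Avail (ModAdd.muxRow L) (2 * L + 1) K Γ := by
  have := Inst.DefsAvail.piece ho (k := 8) (by norm_num) (by rw [pieces_8]; exact ModAdd.wf_muxRow L)
  rw [pieces_8] at this; exact this

/-- The gates of piece `8`. [folklore] -/
theorem e0_8 (o : Occ) (L i : ℕ) : (pieceOcc (o.inst (4 * L)) (pieces L) 8).wire i = (data o L).y1s i := by
  rw [show (pieceOcc (o.inst (4 * L)) (pieces L) 8).wire i = (pieceOcc (o.inst (4 * L)) (pieces L) 8).base + i from rfl, base_q (by norm_num)]; rfl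

/-- The selector input of piece `8`. [folklore] -/
theorem e1_8 (o : Occ) (L : ℕ) : (pieceOcc (o.inst (4 * L)) (pieces L) 8).inp 0 = (data o L).g₁ := by
  rw [inp_q_inr (k := 8) (i := 0) (g := off L 7 + L + 2 * L) (by rw [pieces_8]; dsimp only; unfold wMux; rw [if_pos rfl])]
  exact (by simp only [Nat.add_assoc] : o.base + (off L 7 + L + 2 * L) = o.base + off L 7 + L + 2 * L)

/-- The first data input of piece `8`. [folklore] -/
theorem e2_8 (o : Occ) {L i : ℕ} (hi : i < L) : (pieceOcc (o.inst (4 * L)) (pieces L) 8).inp (1 + i) = (data o L).E1.d L i := by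
  rw [inp_q_inr (k := 8) (i := 1 + i) (g := off L 7 + L + (2 * i + 1)) (by
    simp only [pieces_8, wMux]; rw [if_neg (by omega), if_pos (by omega)]; congr 1; omega)]
  exact (by simp only [Nat.add_assoc] : o.base + (off L 7 + L + (2 * i + 1)) = o.base + off L 7 + L + (2 * i + 1))

/-- The second data input of piece `8`. [folklore] -/
theorem e3_8 (o : Occ) {L i : ℕ} (hi : i < L) : (pieceOcc (o.inst (4 * L)) (pieces L) 8).inp (1 + L + i) = (data o L).Y.s i := by
  rw [inp_q_inr (k := 8) (i := 1 + L + i) (g := off L 6 + (2 * i + 1)) (by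
    simp only [pieces_8, wMux]; rw [if_neg (by omega), if_neg (by omega)]; congr 1; omega)]
  exact (by simp only [Nat.add_assoc] : o.base + (off L 6 + (2 * i + 1)) = o.base + off L 6 + (2 * i + 1))

/-- Availability of the multiplexers `y1s = g₁ ? E1.d : Y`. [folklore] -/
theorem avail_y1s (ho : o.Avail (kitT L) (4 * L) K Γ) : ∀ i < L, ctx K (AssocData.muxLine ((data o L).y1s i) (data o L).g₁ ((data o L).E1.d L i) ((data o L).Y.s i)) ∈ Γ := fun i hi =>
  avail_muxRow' (hq_8 ho) hi (e0_8 o L i) (e1_8 o L) (e2_8 o hi) (e3_8 o hi)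

/-- Availability of the multiplexer row of piece `10`. [folklore] -/
theorem hq_10 (ho : o.Avail (kitT L) (4 * L) K Γ) : (pieceOcc (o.inst (4 * L)) (pieces L) 10).Avail (ModAdd.muxRow L) (2 * L + 1) K Γ := by
  have := Inst.DefsAvail.piece ho (k := 10) (by norm_num) (by rw [pieces_10]; exact ModAdd.wf_muxRow L)
  rw [pieces_10] at this; exact this

/-- The gates of piece `10`. [folklore] -/
theorem e0_10 (o : Occ) (L i : ℕ) : (pieceOcc (o.inst (4 * L)) (pieces L) 10).wire i = (data o L).y1T i := by
  rw [show (pieceOcc (o.inst (4 * L)) (pieces L) 10).wire i = (pieceOcc (o.inst (4 * L)) (pieces L) 10).base + i from rfl, base_q (by norm_num)]; rfl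

/-- The selector input of piece `10`. [folklore] -/
theorem e1_10 (o : Occ) (L : ℕ) : (pieceOcc (o.inst (4 * L)) (pieces L) 10).inp 0 = (data o L).M₁.ge L := by
  rw [inp_q_inr (k := 10) (i := 0) (g := off L 2 + (2 * L + 1) + L + 2 * L) (by rw [pieces_10]; dsimp only; unfold wMux; rw [if_pos rfl])]
  exact (by simp only [Nat.add_assoc] : o.base + (off L 2 + (2 * L + 1) + L + 2 * L) = o.base + off L 2 + (2 * L + 1) + L + 2 * L)

/-- The first data input of piece `10`. [folklore] -/
theorem e2_10 (o : Occ) {L i : ℕ} (hi : i < L) : (pieceOcc (o.inst (4 * L)) (pieces L) 10).inp (1 + i) = (data o L).E1.d L i := by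
  rw [inp_q_inr (k := 10) (i := 1 + i) (g := off L 7 + L + (2 * i + 1)) (by
    simp only [pieces_10, wMux]; rw [if_neg (by omega), if_pos (by omega)]; congr 1; omega)]
  exact (by simp only [Nat.add_assoc] : o.base + (off L 7 + L + (2 * i + 1)) = o.base + off L 7 + L + (2 * i + 1))

/-- The second data input of piece `10`. [folklore] -/
theorem e3_10 (o : Occ) {L i : ℕ} (hi : i < L) : (pieceOcc (o.inst (4 * L)) (pieces L) 10).inp (1 + L + i) = (data o L).Y.s i := by
  rw [inp_q_inr (k := 10) (i := 1 + L + i) (g := off L 6 + (2 * i + 1)) (by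
    simp only [pieces_10, wMux]; rw [if_neg (by omega), if_neg (by omega)]; congr 1; omega)]
  exact (by simp only [Nat.add_assoc] : o.base + (off L 6 + (2 * i + 1)) = o.base + off L 6 + (2 * i + 1))

/-- Availability of the multiplexers `y1T = ge₁ ? E1.d : Y`. [folklore] -/
theorem avail_y1T (ho : o.Avail (kitT L) (4 * L) K Γ) : ∀ i < L, ctx K (AssocData.muxLine ((data o L).y1T i) ((data o L).M₁.ge L) ((data o L).E1.d L i) ((data o L).Y.s i)) ∈ Γ := fun i hi =>
  avail_muxRow' (hq_10 ho) hi (e0_10 o L i) (e1_10 o L) (e2_10 o hi) (e3_10 o hi)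

/-- Availability of the multiplexer row of piece `12`. [folklore] -/
theorem hq_12 (ho : o.Avail (kitT L) (4 * L) K Γ) : (pieceOcc (o.inst (4 * L)) (pieces L) 12).Avail (ModAdd.muxRow L) (2 * L + 1) K Γ := by
  have := Inst.DefsAvail.piece ho (k := 12) (by norm_num) (by rw [pieces_12]; exact ModAdd.wf_muxRow L)
  rw [pieces_12] at this; exact this

/-- The gates of piece `12`. [folklore] -/
theorem e0_12 (o : Occ) (L i : ℕ) : (pieceOcc (o.inst (4 * L)) (pieces L) 12).wire i = (data o L).wT i := by
  rw [show (pieceOcc (o.inst (4 * L)) (pieces L) 12).wire i = (pieceOcc (o.inst (4 * L)) (pieces L) 12).base + i from rfl, base_q (by norm_num)]; rfl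

/-- The selector input of piece `12`. [folklore] -/
theorem e1_12 (o : Occ) (L : ℕ) : (pieceOcc (o.inst (4 * L)) (pieces L) 12).inp 0 = (data o L).M₂.ge L := by
  rw [inp_q_inr (k := 12) (i := 0) (g := off L 4 + (2 * L + 1) + L + 2 * L) (by rw [pieces_12]; dsimp only; unfold wMux; rw [if_pos rfl])]
  exact (by simp only [Nat.add_assoc] : o.base + (off L 4 + (2 * L + 1) + L + 2 * L) = o.base + off L 4 + (2 * L + 1) + L + 2 * L)

/-- The first data input of piece `12`. [folklore] -/
theorem e2_12 (o : Occ) {L i : ℕ} (hi : i < L) : (pieceOcc (o.inst (4 * L)) (pieces L) 12).inp (1 + i) = (data o L).E2T.d L i := by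
  rw [inp_q_inr (k := 12) (i := 1 + i) (g := off L 11 + L + (2 * i + 1)) (by
    simp only [pieces_12, wMux]; rw [if_neg (by omega), if_pos (by omega)]; congr 1; omega)]
  exact (by simp only [Nat.add_assoc] : o.base + (off L 11 + L + (2 * i + 1)) = o.base + off L 11 + L + (2 * i + 1))

/-- The second data input of piece `12`. [folklore] -/
theorem e3_12 (o : Occ) {L i : ℕ} (hi : i < L) : (pieceOcc (o.inst (4 * L)) (pieces L) 12).inp (1 + L + i) = (data o L).y1T i := by
  rw [inp_q_inr (k := 12) (i := 1 + L + i) (g := off L 10 + i) (by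
    simp only [pieces_12, wMux]; rw [if_neg (by omega), if_neg (by omega)]; congr 1; omega)]
  exact (by simp only [Nat.add_assoc] : o.base + (off L 10 + i) = o.base + off L 10 + i)

/-- Availability of the multiplexers `wT = ge₂ ? E2T.d : y1T`. [folklore] -/
theorem avail_wT (ho : o.Avail (kitT L) (4 * L) K Γ) : ∀ i < L, ctx K (AssocData.muxLine ((data o L).wT i) ((data o L).M₂.ge L) ((data o L).E2T.d L i) ((data o L).y1T i)) ∈ Γ := fun i hi =>
  avail_muxRow' (hq_12 ho) hi (e0_12 o L i) (e1_12 o L) (e2_12 o hi) (e3_12 o hi)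

/-- Availability of the multiplexer row of piece `13`. [folklore] -/
theorem hq_13 (ho : o.Avail (kitT L) (4 * L) K Γ) : (pieceOcc (o.inst (4 * L)) (pieces L) 13).Avail (ModAdd.muxRow L) (2 * L + 1) K Γ := by
  have := Inst.DefsAvail.piece ho (k := 13) (by norm_num) (by rw [pieces_13]; exact ModAdd.wf_muxRow L)
  rw [pieces_13] at this; exact this

/-- The gates of piece `13`. [folklore] -/
theorem e0_13 (o : Occ) (L i : ℕ) : (pieceOcc (o.inst (4 * L)) (pieces L) 13).wire i = (data o L).y1V i := by
  rw [show (pieceOcc (o.inst (4 * L)) (pieces L) 13).wire i = (pieceOcc (o.inst (4 * L)) (pieces L) 13).base + i from rfl, base_q (by norm_num)]; rfl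

/-- The selector input of piece `13`. [folklore] -/
theorem e1_13 (o : Occ) (L : ℕ) : (pieceOcc (o.inst (4 * L)) (pieces L) 13).inp 0 = (data o L).M₃.ge L := by
  rw [inp_q_inr (k := 13) (i := 0) (g := off L 3 + (2 * L + 1) + L + 2 * L) (by rw [pieces_13]; dsimp only; unfold wMux; rw [if_pos rfl])]
  exact (by simp only [Nat.add_assoc] : o.base + (off L 3 + (2 * L + 1) + L + 2 * L) = o.base + off L 3 + (2 * L + 1) + L + 2 * L)

/-- The first data input of piece `13`. [folklore] -/
theorem e2_13 (o : Occ) {L i : ℕ} (hi : i < L) : (pieceOcc (o.inst (4 * L)) (pieces L) 13).inp (1 + i) = (data o L).E1.d L i := by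
  rw [inp_q_inr (k := 13) (i := 1 + i) (g := off L 7 + L + (2 * i + 1)) (by
    simp only [pieces_13, wMux]; rw [if_neg (by omega), if_pos (by omega)]; congr 1; omega)]
  exact (by simp only [Nat.add_assoc] : o.base + (off L 7 + L + (2 * i + 1)) = o.base + off L 7 + L + (2 * i + 1))

/-- The second data input of piece `13`. [folklore] -/
theorem e3_13 (o : Occ) {L i : ℕ} (hi : i < L) : (pieceOcc (o.inst (4 * L)) (pieces L) 13).inp (1 + L + i) = (data o L).Y.s i := by
  rw [inp_q_inr (k := 13) (i := 1 + L + i) (g := off L 6 + (2 * i + 1)) (by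
    simp only [pieces_13, wMux]; rw [if_neg (by omega), if_neg (by omega)]; congr 1; omega)]
  exact (by simp only [Nat.add_assoc] : o.base + (off L 6 + (2 * i + 1)) = o.base + off L 6 + (2 * i + 1))

/-- Availability of the multiplexers `y1V = ge₃ ? E1.d : Y`. [folklore] -/
theorem avail_y1V (ho : o.Avail (kitT L) (4 * L) K Γ) : ∀ i < L, ctx K (AssocData.muxLine ((data o L).y1V i) ((data o L).M₃.ge L) ((data o L).E1.d L i) ((data o L).Y.s i)) ∈ Γ := fun i hi =>
  avail_muxRow' (hq_13 ho) hi (e0_13 o L i) (e1_13 o L) (e2_13 o hi) (e3_13 o hi)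

/-- Availability of the multiplexer row of piece `15`. [folklore] -/
theorem hq_15 (ho : o.Avail (kitT L) (4 * L) K Γ) : (pieceOcc (o.inst (4 * L)) (pieces L) 15).Avail (ModAdd.muxRow L) (2 * L + 1) K Γ := by
  have := Inst.DefsAvail.piece ho (k := 15) (by norm_num) (by rw [pieces_15]; exact ModAdd.wf_muxRow L)
  rw [pieces_15] at this; exact this

/-- The gates of piece `15`. [folklore] -/
theorem e0_15 (o : Occ) (L i : ℕ) : (pieceOcc (o.inst (4 * L)) (pieces L) 15).wire i = (data o L).wV i := by
  rw [show (pieceOcc (o.inst (4 * L)) (pieces L) 15).wire i = (pieceOcc (o.inst (4 * L)) (pieces L) 15).base + i from rfl, base_q (by norm_num)]; rfl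

/-- The selector input of piece `15`. [folklore] -/
theorem e1_15 (o : Occ) (L : ℕ) : (pieceOcc (o.inst (4 * L)) (pieces L) 15).inp 0 = (data o L).M₄.ge L := by
  rw [inp_q_inr (k := 15) (i := 0) (g := off L 5 + (2 * L + 1) + L + 2 * L) (by rw [pieces_15]; dsimp only; unfold wMux; rw [if_pos rfl])]
  exact (by simp only [Nat.add_assoc] : o.base + (off L 5 + (2 * L + 1) + L + 2 * L) = o.base + off L 5 + (2 * L + 1) + L + 2 * L)

/-- The first data input of piece `15`. [folklore] -/
theorem e2_15 (o : Occ) {L i : ℕ} (hi : i < L) : (pieceOcc (o.inst (4 * L)) (pieces L) 15).inp (1 + i) = (data o L).E2V.d L i := by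
  rw [inp_q_inr (k := 15) (i := 1 + i) (g := off L 14 + L + (2 * i + 1)) (by
    simp only [pieces_15, wMux]; rw [if_neg (by omega), if_pos (by omega)]; congr 1; omega)]
  exact (by simp only [Nat.add_assoc] : o.base + (off L 14 + L + (2 * i + 1)) = o.base + off L 14 + L + (2 * i + 1))

/-- The second data input of piece `15`. [folklore] -/
theorem e3_15 (o : Occ) {L i : ℕ} (hi : i < L) : (pieceOcc (o.inst (4 * L)) (pieces L) 15).inp (1 + L + i) = (data o L).y1V i := by
  rw [inp_q_inr (k := 15) (i := 1 + L + i) (g := off L 13 + i) (by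
    simp only [pieces_15, wMux]; rw [if_neg (by omega), if_neg (by omega)]; congr 1; omega)]
  exact (by simp only [Nat.add_assoc] : o.base + (off L 13 + i) = o.base + off L 13 + i)

/-- Availability of the multiplexers `wV = ge₄ ? E2V.d : y1V`. [folklore] -/
theorem avail_wV (ho : o.Avail (kitT L) (4 * L) K Γ) : ∀ i < L, ctx K (AssocData.muxLine ((data o L).wV i) ((data o L).M₄.ge L) ((data o L).E2V.d L i) ((data o L).y1V i)) ∈ Γ := fun i hi =>
  avail_muxRow' (hq_15 ho) hi (e0_15 o L i) (e1_15 o L) (e2_15 o hi) (e3_15 o hi)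

/-- Availability of the multiplexer row of piece `18`. [folklore] -/
theorem hq_18 (ho : o.Avail (kitT L) (4 * L) K Γ) : (pieceOcc (o.inst (4 * L)) (pieces L) 18).Avail (ModAdd.muxRow L) (2 * L + 1) K Γ := by
  have := Inst.DefsAvail.piece ho (k := 18) (by norm_num) (by rw [pieces_18]; exact ModAdd.wf_muxRow L)
  rw [pieces_18] at this; exact this

/-- The gates of piece `18`. [folklore] -/
theorem e0_18 (o : Occ) (L i : ℕ) : (pieceOcc (o.inst (4 * L)) (pieces L) 18).wire i = (data o L).zV i := by
  rw [show (pieceOcc (o.inst (4 * L)) (pieces L) 18).wire i = (pieceOcc (o.inst (4 * L)) (pieces L) 18).base + i from rfl, base_q (by norm_num)]; rfl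

/-- The selector input of piece `18`. [folklore] -/
theorem e1_18 (o : Occ) (L : ℕ) : (pieceOcc (o.inst (4 * L)) (pieces L) 18).inp 0 = (data o L).M₃.ge L := by
  rw [inp_q_inr (k := 18) (i := 0) (g := off L 3 + (2 * L + 1) + L + 2 * L) (by rw [pieces_18]; dsimp only; unfold wMux; rw [if_pos rfl])]
  exact (by simp only [Nat.add_assoc] : o.base + (off L 3 + (2 * L + 1) + L + 2 * L) = o.base + off L 3 + (2 * L + 1) + L + 2 * L)

/-- The first data input of piece `18`. [folklore] -/
theorem e2_18 (o : Occ) {L i : ℕ} (hi : i < L) : (pieceOcc (o.inst (4 * L)) (pieces L) 18).inp (1 + i) = (data o L).EAU.d L i := by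
  rw [inp_q_inr (k := 18) (i := 1 + i) (g := off L 17 + L + (2 * i + 1)) (by
    simp only [pieces_18, wMux]; rw [if_neg (by omega), if_pos (by omega)]; congr 1; omega)]
  exact (by simp only [Nat.add_assoc] : o.base + (off L 17 + L + (2 * i + 1)) = o.base + off L 17 + L + (2 * i + 1))

/-- The second data input of piece `18`. [folklore] -/
theorem e3_18 (o : Occ) {L i : ℕ} (hi : i < L) : (pieceOcc (o.inst (4 * L)) (pieces L) 18).inp (1 + L + i) = (data o L).AU.s i := by
  rw [inp_q_inr (k := 18) (i := 1 + L + i) (g := off L 16 + (2 * i + 1)) (by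
    simp only [pieces_18, wMux]; rw [if_neg (by omega), if_neg (by omega)]; congr 1; omega)]
  exact (by simp only [Nat.add_assoc] : o.base + (off L 16 + (2 * i + 1)) = o.base + off L 16 + (2 * i + 1))

/-- Availability of the multiplexers `zV = ge₃ ? EAU.d : AU`. [folklore] -/
theorem avail_zV (ho : o.Avail (kitT L) (4 * L) K Γ) : ∀ i < L, ctx K (AssocData.muxLine ((data o L).zV i) ((data o L).M₃.ge L) ((data o L).EAU.d L i) ((data o L).AU.s i)) ∈ Γ := fun i hi =>
  avail_muxRow' (hq_18 ho) hi (e0_18 o L i) (e1_18 o L) (e2_18 o hi) (e3_18 o hi)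

/-- **All definition lines of the associativity data of an available kit are available.**
[folklore] -/
theorem avail_data (ho : o.Avail (kitT L) (4 * L) K Γ) : (data o L).Avail K Γ :=
  ⟨avail_M₁ ho, avail_M₂ ho, avail_M₃ ho, avail_M₄ ho, avail_A ho, avail_C ho, avail_Y ho, avail_E1 ho, avail_y1s ho,
    avail_E2s ho, avail_y1T ho, avail_E2T ho, avail_wT ho, avail_y1V ho, avail_E2V ho, avail_wV ho, avail_AU ho,
    avail_EAU ho, avail_zV ho⟩

variable {G : FregeSystem}

/-! ### Transferring a comparator fact to a comparator on the same operands -/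

/-- The lines transferring `¬ge` from a comparator `A'` to a comparator `A` on the same operand
variables: reflexivity of the operands, congruence of the two comparators, transport. [folklore] -/
def transferLines (A' A : Sub.View) (K : PropForm ℕ) (L : ℕ) : List (PropForm ℕ) :=
  Adder.reflLines K ((List.range L).map A.x ++ (List.range L).map A.y) ++
    (Sub.leibLines A' A K L ++ [ctx K (neg (var (A.ge L L)))])

/-- **Transfer of a strict comparison**: if `A'` and `A` compare the same operand variables and
`A'` answers `<`, then so does `A`. [cite: CookReckhow1979, §2] -/
theorem isBlock_transferLines (hGN : ∀ r ∈ Netlist.rules, r ∈ G.rules) (hGA : ∀ r ∈ Adder.rules, r ∈ G.rules)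
    (hGL : ∀ r ∈ Logic.rules, r ∈ G.rules) {A' A : Sub.View} {K : PropForm ℕ} {T : Set (PropForm ℕ)} {L : ℕ}
    (hA' : A'.Avail K T L) (hA : A.Avail K T L) (hx : ∀ i < L, A'.x i = A.x i) (hy : ∀ i < L, A'.y i = A.y i)
    (hlt : ctx K (neg (var (A'.ge L L))) ∈ T) : G.IsBlock T (transferLines A' A K L) := by
  refine (Adder.isBlock_reflLines hGA K _ T).append ((Sub.isBlock_leibLines hGN hGL A' A
    (hA'.mono Set.subset_union_left) (hA.mono Set.subset_union_left) (fun i hi => ?_) (fun i hi => ?_)).append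
    (FregeSystem.IsBlock.singleton (Or.inr (Logic.infer hGL 8 (by decide)
      (FregeSystem.sub [K, var (A'.ge L L), var (A.ge L L)]) rfl
      (FregeSystem.prems_cons (Or.inl (Or.inl hlt)) (FregeSystem.prems_cons
        (Or.inr (Sub.mem_leibLines (k := 2 * L) (by omega))) FregeSystem.prems_nil))))))
  · rw [hx i hi]
    exact Or.inr (Adder.mem_reflLines (List.mem_append_left _ (List.mem_map.2 ⟨i, List.mem_range.2 hi, rfl⟩)))
  · rw [hy i hi]
    exact Or.inr (Adder.mem_reflLines (List.mem_append_right _ (List.mem_map.2 ⟨i, List.mem_range.2 hi, rfl⟩)))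

/-- The conclusion of the transfer. [folklore] -/
theorem mem_transferLines (A' A : Sub.View) (K : PropForm ℕ) (L : ℕ) :
    ctx K (neg (var (A.ge L L))) ∈ transferLines A' A K L :=
  List.mem_append_right _ (List.mem_append_right _ (List.mem_singleton_self _))

/-- Size of the transfer. [folklore] -/
theorem proofSize_transferLines (A' A : Sub.View) (K : PropForm ℕ) (L : ℕ) :
    proofSize (transferLines A' A K L) ≤ (5 * L + 2) * (K.size + 10) := by
  rw [transferLines, proofSize_append, proofSize_append, Adder.proofSize_reflLines, proofSize_singleton]
  have h₁ := Sub.proofSize_leibLines A' A K L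
  simp only [List.length_append, List.length_map, List.length_range, ctx, size]
  nlinarith [h₁]

/-! ### The associativity block of an available kit -/

/-- The output `R(M₂)ᵢ = ((a ⊕ b) ⊕ c)ᵢ` of the kit. [folklore] -/
def out₂ (o : Occ) (L i : ℕ) : ℕ := o.base + off L 4 + (5 * L + 2) + i
/-- The output `R(M₄)ᵢ = (a ⊕ (b ⊕ c))ᵢ` of the kit. [folklore] -/
def out₄ (o : Occ) (L i : ℕ) : ℕ := o.base + off L 5 + (5 * L + 2) + i

/-- **The associativity block of an available kit.** From the availability of an occurrence of
the kit, the facts that the operand bits `a, b, c` are false from position `m` on (`m + 2 ≤ L`),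
and the facts `a < n`, `c < n` about the kit's own
comparators (obtained from a consumer's comparators by `isBlock_transferLines`), the lines of
`ModAddU.AssocData.isBlock_lines` for the kit's data form a block.
[cite: CookReckhow1979, §2; Krajicek1995, §9.2] -/
theorem isBlock (hG : ∀ r ∈ assocRules, r ∈ G.rules) (hGN : ∀ r ∈ Netlist.rules, r ∈ G.rules)
    (hGA : ∀ r ∈ Adder.rules, r ∈ G.rules) (hGL : ∀ r ∈ Logic.rules, r ∈ G.rules)
    (hGG : ∀ r ∈ glueRules, r ∈ G.rules) (ho : o.Avail (kitT L) (4 * L) K Γ) {m : ℕ} (hm : m + 2 ≤ L)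
    (ha : ∀ i, m ≤ i → i < L → ctx K (neg (var (o.inp i))) ∈ Γ)
    (hb : ∀ i, m ≤ i → i < L → ctx K (neg (var (o.inp (L + i)))) ∈ Γ)
    (hc : ∀ i, m ≤ i → i < L → ctx K (neg (var (o.inp (2 * L + i)))) ∈ Γ)
    (hA : ctx K (neg (var ((data o L).A.ge L L))) ∈ Γ) (hC : ctx K (neg (var ((data o L).C.ge L L))) ∈ Γ) :
    G.IsBlock Γ ((data o L).lines K) :=
  (data o L).isBlock_lines hG hGN hGA hGL hGG (avail_data ho) hm ha hb hc hA hC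

/-- **The conclusion of the kit**: `((a ⊕ b) ⊕ c)ᵢ ↔ (a ⊕ (b ⊕ c))ᵢ` for `i < L`. [folklore] -/
theorem mem {i : ℕ} (hi : i < L) : ctx K (eqv (out₂ o L i) (out₄ o L i)) ∈ (data o L).lines K :=
  (data o L).mem_lines hi

/-- **Size of the kit's block**: `≤ (82L + 65)(|K| + 140)`. [folklore] -/
theorem proofSize_le : proofSize ((data o L).lines K) ≤ (82 * L + 65) * (K.size + 140) :=
  (data o L).proofSize_lines K

end AssocKit

end ModAddU

end Literature.Computability.MetaComplexity
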